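import Literature.AlgebraicGeometry.Resolution.BertiniAffine
import Mathlib.RingTheory.KrullDimension.Regular
import Mathlib.RingTheory.Localization.Submodule
import HarnessLib

/-!
# The local ring of the full cobordant blow-up at an exceptional closed point

Topic: `Summits/ResolutionOfSingularities/ResolutionOfSingularities/Theorems`. Helpers (part 3 of 3) for
the stub `stub_formalChart` (formal-chart package) of the line `support-first-weights-second` of the crux
`Theses.WeightedInvariant.WeightedConstruction` (statement `stmt-ResolutionOfSingularities-0571`). The ring
theory of the full cobordant blow-up `B = Spec A[t⁻¹, uᵢ t^{wᵢ}]` at an exceptional point, for an ABSTRACT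
`A`-algebra `E` with an element `t` and elements `uᵢ'` such that `uᵢ = t^{wᵢ} uᵢ'`, `E` is generated over `A`
by `t` and the `uᵢ'` modulo `(t, uᵢ' − cᵢ)`, `t` is a non-zero-divisor and `E/(t) ≅ (A/(u))[X]` (`uᵢ' ↦ Xᵢ`)
— all supplied for `E = A[t⁻¹, uᵢ t^{wᵢ}]`, `t = t⁻¹` by `…FormalChartAlgebra` — and a prime `𝔭 ∋ t` of `E`
with `uᵢ' ≡ cᵢ mod 𝔭`, over a prime `𝔮` of `A` at which `(u, v)` generate the maximal ideal of `A_𝔮`: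

* `span_chart_eq_maximalIdeal` — `t⁻¹`, the `uᵢ' − cᵢ` and the `vⱼ` generate the maximal ideal of the
  localisation at `𝔭`;
* `ringKrullDim_eq_of_chart` — if moreover `𝔭`, `𝔮` are maximal and `dim A_𝔮 = m + n`, the localisation at
  `𝔭` has dimension `m + n + 1` (`t⁻¹` is a non-zero-divisor; the exceptional fibre `(A/(u))[X]` at the
  rational point `(𝔮/(u), Xᵢ − cᵢ)` has height `ht(𝔮/(u)) + m` by flatness of `A/(u) → (A/(u))[X]`; and
  `ht(𝔮/(u)) ≥ n`) — Włodarczyk §4.1: the exceptional divisor of `B → X` is the weighted normal bundle of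
  the centre, of dimension `dim X`;
* `ringKrullDim_quotient_map_eq_height` — localisation commutes with quotients, in dimension.

## Sources

* J. Włodarczyk, *Functorial resolution by torus actions*, arXiv:2203.03090, §2.3.9, §4.1. [Wlodarczyk2022]
* H. Matsumura, *Commutative Ring Theory*, CUP 1986, Thm. 15.1 (dimension of flat extensions). [Matsumura1987]
-/

noncomputable section

open CategoryTheory CategoryTheory.Limits AlgebraicGeometry TopologicalSpace
open Literature.AlgebraicGeometry.Resolution IsLocalRing
open scoped LaurentPolynomial

-- the summit namespace repeats `ResolutionOfSingularities` by design
set_option linter.dupNamespace false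

namespace Summit.ResolutionOfSingularities.ResolutionOfSingularities.Theorems

universe u

/-! ## The local ring of `B` at an exceptional point: generators of `𝔪` and dimension -/

/-- **Localization commutes with quotients, in dimension**: for `J ≤ P` and a localization `T` of
`R` at the prime `P`, `T ⧸ J T` is the localization of `R ⧸ J` at `P ⧸ J`, so its Krull dimension is
the height of `P ⧸ J`. [folklore] -/
theorem ringKrullDim_quotient_map_eq_height {R : Type u} [CommRing R] (J P : Ideal R) [P.IsPrime]
    (hJP : J ≤ P) (T : Type u) [CommRing T] [Algebra R T] [IsLocalization.AtPrime T P] :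
    ringKrullDim (T ⧸ J.map (algebraMap R T)) =
      @Ideal.height _ _ (P.map (Ideal.Quotient.mk J)) := by
  haveI := BertiniAffine.isPrime_map_mk J P hJP
  haveI := BertiniAffine.liesOver_map_mk J P hJP
  have h : Algebra.algebraMapSubmonoid (R ⧸ J) P.primeCompl =
      (P.map (Ideal.Quotient.mk J)).primeCompl :=
    Ideal.algebraMapSubmonoid_primeCompl_of_liesOver_surjective (P := P.map (Ideal.Quotient.mk J))
      (p := P) Ideal.Quotient.mk_surjective
  haveI : IsLocalization.AtPrime (T ⧸ J.map (algebraMap R T)) (P.map (Ideal.Quotient.mk J)) := by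
    rw [IsLocalization.AtPrime, ← h]
    infer_instance
  exact IsLocalization.AtPrime.ringKrullDim_eq_height _ _

section LocalStructure

open LaurentPolynomial

variable {A : Type u} [CommRing A] {m n : ℕ} (u : Fin m → A) (w : Fin m → ℕ)
  {E : Type u} [CommRing E] [Algebra A E] (t : E) (u' : Fin m → E)
  (halg : ∀ i, algebraMap A E (u i) = t ^ w i * u' i) (hw : ∀ i, 0 < w i) (v : Fin n → A) (c : Fin m → A)
  (hgenE : ∀ J : Ideal E, t ∈ J → (∀ i, u' i - algebraMap A E (c i) ∈ J) → ∀ x : E, ∃ a : A, x - algebraMap A E a ∈ J)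
  (𝔭 : Ideal E) [𝔭.IsPrime] (hs𝔭 : t ∈ 𝔭) (hc𝔭 : ∀ i, u' i - algebraMap A E (c i) ∈ 𝔭)
  (S : Type u) [CommRing S] [IsLocalRing S] [Algebra A S] [IsLocalization.AtPrime S (𝔭.comap (algebraMap A E))]
  (hgen : Ideal.span (Set.range fun i => algebraMap A S (Fin.append u v i)) = maximalIdeal S)
  (L : Type u) [CommRing L] [IsLocalRing L] [Algebra E L] [IsLocalization.AtPrime L 𝔭]
  (z : Fin (m + n + 1) → L) (hz0 : z 0 = algebraMap E L t)
  (hzu : ∀ i, z (Fin.castAdd n i).succ = algebraMap E L (u' i - algebraMap A E (c i)))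
  (hzv : ∀ j, z (Fin.natAdd m j).succ = algebraMap E L (algebraMap A E (v j)))

include halg hw hgenE hs𝔭 hc𝔭 hgen hz0 hzu hzv in
/-- **The maximal ideal of `B` at an exceptional point**: if `t⁻¹ ∈ 𝔭`, `uᵢ' ≡ cᵢ mod 𝔭` and the
`uᵢ, vⱼ` generate the maximal ideal of the base local ring at the image point, then `t⁻¹`, the
`uᵢ' − cᵢ` and the `vⱼ` (listed as `z`, in the order `(t⁻¹; u-slots; v-slots)`) generate the maximal ideal
of `𝒪_{B,b} = E_𝔭` (every element of the algebra is a constant modulo `(t, uᵢ' − cᵢ)`, and a constant in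
`𝔭` lies in `(u, v)` up to a unit, with `uᵢ = t^{wᵢ} uᵢ'`; Włodarczyk §2.3.9/§4.1: the
exceptional divisor is the weighted normal bundle `Spec (𝒪/(u))[u']`). [cite: Wlodarczyk2022, §2.3.9] -/
theorem span_chart_eq_maximalIdeal : Ideal.span (Set.range z) = maximalIdeal L := by
  set 𝔮 : Ideal A := 𝔭.comap (algebraMap A E) with h𝔮
  set JE : Ideal E := Ideal.span (insert t
    (Set.range (fun i => u' i - algebraMap A E (c i)) ∪ Set.range (fun j => algebraMap A E (v j)))) with hJE
  have htJE : t ∈ JE := Ideal.subset_span (Set.mem_insert _ _)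
  have huJE : ∀ i, u' i - algebraMap A E (c i) ∈ JE := fun i =>
    Ideal.subset_span (Set.mem_insert_of_mem _ (Or.inl ⟨i, rfl⟩))
  have hvJE : ∀ j, algebraMap A E (v j) ∈ JE := fun j =>
    Ideal.subset_span (Set.mem_insert_of_mem _ (Or.inr ⟨j, rfl⟩))
  have hv𝔭 : ∀ j, algebraMap A E (v j) ∈ 𝔭 := fun j => by
    rw [← Ideal.mem_comap, ← h𝔮, ← IsLocalization.AtPrime.to_map_mem_maximal_iff S 𝔮, ← hgen]
    exact Ideal.subset_span ⟨Fin.natAdd m j, by simp⟩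
  have hJE𝔭 : JE ≤ 𝔭 := by
    rw [hJE, Ideal.span_le]
    rintro _ (rfl | ⟨i, rfl⟩ | ⟨j, rfl⟩)
    exacts [hs𝔭, hc𝔭 i, hv𝔭 j]
  have hJEL : JE.map (algebraMap E L) ≤ Ideal.span (Set.range z) := by
    rw [hJE, Ideal.map_span, Ideal.span_le]
    rintro _ ⟨_, (rfl | ⟨i, rfl⟩ | ⟨j, rfl⟩), rfl⟩
    · exact Ideal.subset_span ⟨0, hz0⟩
    · exact Ideal.subset_span ⟨(Fin.castAdd n i).succ, hzu i⟩
    · exact Ideal.subset_span ⟨(Fin.natAdd m j).succ, hzv j⟩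
  have happJE : (Ideal.span (Set.range (Fin.append u v))).map (algebraMap A E) ≤ JE := by
    rw [Ideal.map_span, Ideal.span_le]
    rintro _ ⟨_, ⟨i, rfl⟩, rfl⟩
    refine Fin.addCases (fun i => ?_) (fun j => ?_) i
    · rw [Fin.append_left, halg]
      exact JE.mul_mem_right _ (JE.pow_mem_of_mem htJE _ (hw i))
    · rw [Fin.append_right]
      exact hvJE j
  apply le_antisymm
  · rw [← IsLocalization.AtPrime.map_eq_maximalIdeal 𝔭 L, Ideal.span_le]
    rintro _ ⟨i, rfl⟩
    refine Fin.cases ?_ (fun i => ?_) i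
    · rw [hz0]
      exact Ideal.mem_map_of_mem _ hs𝔭
    · refine Fin.addCases (fun i => ?_) (fun j => ?_) i
      · rw [hzu]
        exact Ideal.mem_map_of_mem _ (hc𝔭 i)
      · rw [hzv]
        exact Ideal.mem_map_of_mem _ (hv𝔭 j)
  · rw [← IsLocalization.AtPrime.map_eq_maximalIdeal 𝔭 L, Ideal.map_le_iff_le_comap]
    intro x hx
    obtain ⟨a, ha⟩ := hgenE JE htJE huJE x
    have ha𝔮 : a ∈ 𝔮 := by
      rw [h𝔮, Ideal.mem_comap]
      simpa using 𝔭.sub_mem hx (hJE𝔭 ha)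
    have haS : algebraMap A S a ∈
        (Ideal.span (Set.range (Fin.append u v))).map (algebraMap A S) := by
      rw [Ideal.map_span, ← Set.range_comp]
      change algebraMap A S a ∈ Ideal.span (Set.range fun i => algebraMap A S (Fin.append u v i))
      rw [hgen]
      exact (IsLocalization.AtPrime.to_map_mem_maximal_iff S 𝔮 a).mpr ha𝔮
    rw [IsLocalization.mem_map_algebraMap_iff 𝔮.primeCompl S] at haS
    obtain ⟨⟨⟨i, hi⟩, ⟨s, hs⟩⟩, his⟩ := haS
    obtain ⟨⟨t', ht'⟩, h'⟩ := (IsLocalization.eq_iff_exists 𝔮.primeCompl S).mp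
      (show algebraMap A S (a * s) = algebraMap A S i by rw [map_mul]; exact his)
    have hmem : algebraMap A E (t' * (a * s)) ∈ JE := by
      rw [show (t' : A) * (a * s) = t' * i from h', map_mul]
      exact JE.mul_mem_left _ (happJE (Ideal.mem_map_of_mem _ hi))
    have hunit : IsUnit (algebraMap E L (algebraMap A E (t' * s))) := by
      refine IsLocalization.map_units L (⟨algebraMap A _ (t' * s), ?_⟩ : 𝔭.primeCompl)
      change algebraMap A _ (t' * s) ∉ 𝔭
      rw [← Ideal.mem_comap, ← h𝔮]
      exact 𝔮.primeCompl.mul_mem ht' hs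
    have e1 : algebraMap E L x =
        algebraMap _ L (algebraMap A E a) + algebraMap _ L (x - algebraMap A _ a) := by
      rw [map_sub]; ring
    rw [Ideal.mem_comap, e1]
    refine Ideal.add_mem _ ?_ (hJEL (Ideal.mem_map_of_mem _ ha))
    rw [← Ideal.unit_mul_mem_iff_mem _ hunit, ← map_mul, ← map_mul]
    refine hJEL (Ideal.mem_map_of_mem _ ?_)
    convert hmem using 2
    ring

include halg hw hgenE hs𝔭 hc𝔭 hgen hz0 hzu hzv in
/-- **The dimension of `B` at an exceptional closed point** is `dim 𝒪_{Y,y} + 1 = m + n + 1`: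
`≤` from the `m + n + 1` generators of `𝔪_b`; `≥` because `t` is a non-zero-divisor
(`dim 𝒪_{B,b} = dim 𝒪_{B,b}/(t) + 1`), `𝒪_{B,b}/(t) ≅` the local ring of `(A/(u))[X₁, …, Xₘ]`
at the rational point `(𝔮/(u), Xᵢ − cᵢ)` over the closed point `𝔮`, of height `ht(𝔮/(u)) + m`
(flatness of `A/(u) → (A/(u))[X]`), and `ht(𝔮/(u)) ≥ ht 𝔮 − m = n` (Włodarczyk §4.1: the
exceptional divisor of `B → X` is the weighted normal bundle of the centre, of dimension `dim X`).
[cite: Wlodarczyk2022, §2.3.9] -/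
theorem ringKrullDim_eq_of_chart [IsNoetherianRing A] [IsNoetherianRing E] {k : Type u} [Field k] [Algebra k A]
    (ck : Fin m → k) (hck : ∀ i, c i = algebraMap k A (ck i)) [𝔭.IsMaximal]
    (h𝔮 : (𝔭.comap (algebraMap A E)).IsMaximal) (ht0 : t ∈ nonZeroDivisors E)
    (hfib : ∃ e : (E ⧸ Ideal.span {t}) ≃+* MvPolynomial (Fin m) (A ⧸ Ideal.span (Set.range u)),
      (∀ i, e (Ideal.Quotient.mk _ (u' i)) = MvPolynomial.X i) ∧
      ∀ a : A, e (Ideal.Quotient.mk _ (algebraMap A E a)) = MvPolynomial.C (Ideal.Quotient.mk _ a))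
    (hdimS : ringKrullDim S = (m + n : ℕ)) :
    ringKrullDim L = (m + n + 1 : ℕ) := by
  classical
  haveI : IsNoetherianRing L := IsLocalization.isNoetherianRing 𝔭.primeCompl L inferInstance
  set 𝔮 : Ideal A := 𝔭.comap (algebraMap A E) with h𝔮def
  have hu𝔮 : ∀ i, u i ∈ 𝔮 := fun i => by
    rw [h𝔮def, ← IsLocalization.AtPrime.to_map_mem_maximal_iff S (𝔭.comap (algebraMap A _)), ← hgen]
    exact Ideal.subset_span ⟨Fin.castAdd n i, by simp⟩
  -- upper bound: `𝔪_b` has `m + n + 1` generators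
  have hup : ringKrullDim L ≤ (m + n + 1 : ℕ) := by
    let sL : Finset L := Finset.univ.image z
    have hsL : Ideal.span (sL : Set L) = maximalIdeal L := by
      rw [← span_chart_eq_maximalIdeal u w t u' halg hw v c hgenE 𝔭 hs𝔭 hc𝔭 S hgen L z hz0 hzu hzv]
      congr 1
      simp [sL]
    have h1 := ringKrullDim_le_ringKrullDim_quotient_add_card sL (by
      rw [IsLocalRing.ringJacobson_eq_maximalIdeal, ← hsL]; exact Ideal.subset_span)
    have h2 : ringKrullDim (L ⧸ Ideal.span (sL : Set L)) = 0 := by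
      rw [hsL]
      exact ringKrullDim_eq_zero_of_isField
        ((Ideal.Quotient.maximal_ideal_iff_isField_quotient _).mp inferInstance)
    have h3 : sL.card ≤ m + n + 1 := Finset.card_image_le.trans (by simp)
    rw [h2, zero_add] at h1
    exact h1.trans (by exact_mod_cast h3)
  -- the height of `𝔭`
  have hLdim : ringKrullDim L = 𝔭.height := IsLocalization.AtPrime.ringKrullDim_eq_height 𝔭 L
  -- (α) `t` is a non-zero-divisor in `𝔪`: `dim 𝒪_{B,b} = dim 𝒪_{B,b}/(t) + 1`
  have htL : algebraMap E L t ∈ nonZeroDivisors L :=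
    IsLocalization.map_nonZeroDivisors_le 𝔭.primeCompl L (Submonoid.mem_map_of_mem _ ht0)
  have htLm : algebraMap E L t ∈ maximalIdeal L :=
    (IsLocalization.AtPrime.to_map_mem_maximal_iff L 𝔭 _).mpr hs𝔭
  have hα : ringKrullDim (L ⧸ Ideal.span {algebraMap E L t}) + 1 = ringKrullDim L :=
    ringKrullDim_quotient_span_singleton_succ_eq_ringKrullDim_of_mem_nonZeroDivisors htL htLm
  have hle : Ideal.span {t} ≤ 𝔭 := by
    rw [Ideal.span_le, Set.singleton_subset_iff]; exact hs𝔭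
  haveI h𝔭barp : (𝔭.map (Ideal.Quotient.mk (Ideal.span {t}))).IsPrime :=
    BertiniAffine.isPrime_map_mk (Ideal.span {t}) 𝔭 hle
  -- `dim 𝒪_{B,b}/(t) = ht (𝔭/(t))`
  have hquot := ringKrullDim_quotient_map_eq_height _ 𝔭 hle L
  rw [Ideal.map_span, Set.image_singleton] at hquot
  -- (β, γ) `𝔭/(t)` is the rational point `(𝔮/(u), Xᵢ − cᵢ)` of `(A/(u))[X]`
  obtain ⟨ē, hē₁, hē₂⟩ := hfib
  have hle' : Ideal.span (Set.range u) ≤ 𝔮 := by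
    rw [Ideal.span_le]; rintro _ ⟨i, rfl⟩; exact hu𝔮 i
  haveI h𝔮barp : (𝔮.map (Ideal.Quotient.mk (Ideal.span (Set.range u)))).IsPrime := BertiniAffine.isPrime_map_mk _ 𝔮 hle'
  haveI h𝔮barm : (𝔮.map (Ideal.Quotient.mk (Ideal.span (Set.range u)))).IsMaximal := (Ideal.map_eq_top_or_isMaximal_of_surjective _
    Ideal.Quotient.mk_surjective h𝔮).resolve_left h𝔮barp.ne_top
  haveI h𝔭barm : (𝔭.map (Ideal.Quotient.mk (Ideal.span {t}))).IsMaximal := (Ideal.map_eq_top_or_isMaximal_of_surjective _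
    Ideal.Quotient.mk_surjective ‹𝔭.IsMaximal›).resolve_left h𝔭barp.ne_top
  set Q : Ideal (MvPolynomial (Fin m) (A ⧸ Ideal.span (Set.range u))) :=
    (𝔮.map (Ideal.Quotient.mk (Ideal.span (Set.range u)))).comap (BertiniAffine.evalPoly (A := A ⧸ Ideal.span (Set.range u)) ck).toRingHom with hQ
  haveI hQmax : Q.IsMaximal :=
    Ideal.comap_isMaximal_of_surjective _ (BertiniAffine.evalPoly_surjective ck)
  have hQeq : (𝔭.map (Ideal.Quotient.mk (Ideal.span {t}))).map ē = Q := by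
    symm
    refine hQmax.eq_of_le (Ideal.IsMaximal.ne_top inferInstance) fun P hP => ?_
    have hsplit : P = (P - MvPolynomial.C (BertiniAffine.evalPoly ck P)) +
        MvPolynomial.C (BertiniAffine.evalPoly ck P) := by ring
    rw [hsplit]
    refine Ideal.add_mem _ ?_ ?_
    · have hker : P - MvPolynomial.C (BertiniAffine.evalPoly ck P) ∈
          RingHom.ker (BertiniAffine.evalPoly (A := A ⧸ Ideal.span (Set.range u)) ck).toRingHom := by
        rw [RingHom.mem_ker]
        simp
      rw [BertiniAffine.ker_evalPoly] at hker
      refine (Ideal.span_le.mpr ?_ : Ideal.span _ ≤ (𝔭.map (Ideal.Quotient.mk (Ideal.span {t}))).map ē) hker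
      rintro _ ⟨j, rfl⟩
      have : (MvPolynomial.X j - MvPolynomial.C (algebraMap k (A ⧸ Ideal.span (Set.range u)) (ck j)) :
          MvPolynomial (Fin m) (A ⧸ Ideal.span (Set.range u))) =
          ē (Ideal.Quotient.mk _ (u' j - algebraMap A _ (c j))) := by
        rw [RingHom.map_sub, ē.map_sub, hē₁, hē₂, hck,
          IsScalarTower.algebraMap_apply k A (A ⧸ Ideal.span (Set.range u)), Ideal.Quotient.algebraMap_eq]
      change MvPolynomial.X j - MvPolynomial.C _ ∈ _
      rw [this]
      exact Ideal.mem_map_of_mem _ (Ideal.mem_map_of_mem _ (hc𝔭 j))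
    · have hev : BertiniAffine.evalPoly ck P ∈ (𝔮.map (Ideal.Quotient.mk (Ideal.span (Set.range u)))) := by
        rw [hQ, Ideal.mem_comap] at hP; exact hP
      obtain ⟨a, ha, hae⟩ := (Ideal.mem_map_iff_of_surjective _ Ideal.Quotient.mk_surjective).mp hev
      rw [← hae, ← hē₂]
      refine Ideal.mem_map_of_mem _ (Ideal.mem_map_of_mem _ ?_)
      rw [h𝔮def, Ideal.mem_comap] at ha
      exact ha
  -- (δ) `ht (𝔮/(u), X − c) = ht (𝔮/(u)) + m`
  have hQht : Q.height = (𝔮.map (Ideal.Quotient.mk (Ideal.span (Set.range u)))).height + m := by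
    rw [hQ, BertiniAffine.height_comap_evalPoly (𝔮.map (Ideal.Quotient.mk (Ideal.span (Set.range u)))) ck]
    simp
  have h𝔭barht : (𝔭.map (Ideal.Quotient.mk (Ideal.span {t}))).height = (𝔮.map (Ideal.Quotient.mk (Ideal.span (Set.range u)))).height + m := by
    rw [← ē.height_map (𝔭.map (Ideal.Quotient.mk (Ideal.span {t}))), hQeq, hQht]
  -- (ε) `ht (𝔮/(u)) ≥ ht 𝔮 − m = n`, computed in the localization `S` of `A` at `𝔮`
  have hε : (n : ℕ∞) ≤ (𝔮.map (Ideal.Quotient.mk (Ideal.span (Set.range u)))).height := by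
    haveI : IsNoetherianRing S := IsLocalization.isNoetherianRing 𝔮.primeCompl S inferInstance
    let sU : Finset S := Finset.univ.image (fun i => algebraMap A S (u i))
    have hsU : Ideal.span (sU : Set S) = (Ideal.span (Set.range u)).map (algebraMap A S) := by
      rw [Ideal.map_span, ← Set.range_comp]
      congr 1
      simp [sU, Function.comp_def]
    have h1 := ringKrullDim_le_ringKrullDim_quotient_add_card sU (by
      rw [IsLocalRing.ringJacobson_eq_maximalIdeal]
      intro x hx
      simp only [sU, Finset.coe_image, Finset.coe_univ, Set.image_univ, Set.mem_range] at hx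
      obtain ⟨i, rfl⟩ := hx
      exact (IsLocalization.AtPrime.to_map_mem_maximal_iff S 𝔮 _).mpr (hu𝔮 i))
    have h2 := ringKrullDim_quotient_map_eq_height _ 𝔮 hle' S
    rw [← hsU] at h2
    have h3 : sU.card ≤ m := Finset.card_image_le.trans (by simp)
    rw [hdimS, h2] at h1
    have h4 : ((m + n : ℕ) : WithBot ℕ∞) ≤ (((𝔮.map (Ideal.Quotient.mk (Ideal.span (Set.range u)))).height + m : ℕ∞) : WithBot ℕ∞) := by
      refine h1.trans ?_
      rw [WithBot.coe_add]
      gcongr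
      exact_mod_cast h3
    by_cases htop : (𝔮.map (Ideal.Quotient.mk (Ideal.span (Set.range u)))).height = ⊤
    · rw [htop]; exact le_top
    · obtain ⟨h', hh'⟩ := ENat.ne_top_iff_exists.mp htop
      rw [← hh'] at h4 ⊢
      have : m + n ≤ h' + m := by exact_mod_cast h4
      exact_mod_cast (by omega : n ≤ h')
  -- conclusion
  refine le_antisymm hup ?_
  rw [← hα, hquot, h𝔭barht]
  have key : ((m + n + 1 : ℕ) : ℕ∞) ≤
      (𝔮.map (Ideal.Quotient.mk (Ideal.span (Set.range u)))).height + m + 1 := by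
    by_cases htop : (𝔮.map (Ideal.Quotient.mk (Ideal.span (Set.range u)))).height = ⊤
    · rw [htop, top_add, top_add]
      exact le_top
    · obtain ⟨h', hh'⟩ := ENat.ne_top_iff_exists.mp htop
      rw [← hh'] at hε ⊢
      have : n ≤ h' := by exact_mod_cast hε
      exact_mod_cast (by omega : m + n + 1 ≤ h' + m + 1)
  rw [← WithBot.coe_natCast, ← WithBot.coe_one, ← WithBot.coe_add]
  exact WithBot.coe_le_coe.mpr key

end LocalStructure

/-! ## Registered anchor of this helper file -/

/-- Registered anchor (`stub_formalChart_local`, helper 3/3 of `stub_formalChart`): localisation commutes with quotients,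
in dimension (`ringKrullDim_quotient_map_eq_height`, at `Type`). [folklore] -/
theorem stub_formalChart_local : ∀ {R : Type} [CommRing R] (J P : Ideal R) [P.IsPrime], J ≤ P → ∀ (T : Type) [CommRing T] [Algebra R T] [IsLocalization.AtPrime T P], ringKrullDim (T ⧸ J.map (algebraMap R T)) = @Ideal.height _ _ (P.map (Ideal.Quotient.mk J)) :=
  fun J P _ hJP T _ _ _ => ringKrullDim_quotient_map_eq_height J P hJP T

end Summit.ResolutionOfSingularities.ResolutionOfSingularities.Theorems

end
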